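import Literature.MathematicalPhysics.QuantumFieldTheory.Balaban1983to89.B9Thm314GpFlatTorusGeometry

/-!
# `Balaban1983to89.B9Thm314GpFlatResolvent` — [B9] THEOREM 3.14 (pp. 426–427, (3.154)) AT `U = 1` ON THE GENUINE
`k`-LEVEL TORUS, FILE 2 OF 3: THE RESOLVENT ESTIMATE — for two nested families `D, D′` on one torus `T_η`, outer factors
`A_L, A_R` and top blocks `y ∋ x`, `y′ ⊃ supp λ` of `Ω = Ω_k ∩ Ω′_k`,
`|((A_L·G′[D]·(Δ′[D′] − Δ′[D])·G′[D′]·A_R)λ)(x)| ≤ K_L(y)·2C_Ra₊L²e^{(3/2)δ}c·(L^{mk}/L^{2k})·e^{−½δ·d(y,y′,Ω)}·|λ|`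
from the block majorants of `A_L·G′[D]` and `G′[D′]·A_R` (no existing module is touched; no fact is minted)

FRAMING (verbatim cell line):
statement-level skeleton of published theorems with citation tags; proofs where landed; nothing here is a claim about the Yang–Mills mass gap

Sources under audit (cell pub-balaban / lit-balaban): T. Bałaban, *Propagators for lattice gauge theories in a
background field*, Commun. Math. Phys. **99** (1985) 389–434 [`Balaban1985BackgroundPropagators`, "B9"], pp. 426–427
[PDF 38–39] (Theorem 3.14, (3.154); held text `paper:balaban1985-cmp99-background-propagators` p0038/p0039, read this
generation), p. 397 (3.42); T. Bałaban, *Propagators and renormalization transformations for lattice gauge theories. II*,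
Commun. Math. Phys. **96** (1984) 223–250 [`Balaban1984PropagatorsII`, "[4]"], (2.14) p. 225, (2.67) p. 234,
(2.60)–(2.61) p. 234, p. 235 (the weight transfer after (2.68)).  Unit `lit-balaban-p21` (Phase-2 proof seat p21 gen 18,
HOME `run/shared/lean/pub/lit-balaban/`, free-target protocol G.5-34(d); B9 fold owner r06, B6 fold owner r03, referee ref-4).

## WHAT IS PRINTED (B9 pp. 426–427, verbatim up to notation)

«… two sequences of domains {Ω_j}, {Ω′_j}, both satisfying the conditions (2.1)-(2.4) in [4], with M and R sufficiently
large … We construct operators for both sequences and we define Ω = Ω_k ∩ Ω′_k. Let us take localizations determined by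
points y, y′ ∈ Ω^{(k)} … **Theorem 3.14.** If we take a pair of operators constructed for the two sequences {Ω_j}, {Ω′_j},
then their difference satisfies all the inequalities characteristic for operators of the considered type, with the
additional factor exp(−δ₀d(y, y′, Ω)), d(y, y′, Ω) = inf_{y₁∈Ωᶜ∩T^{(k)}} (|y − y₁| + |y₁ − y′|) (3.154) on the right-hand
sides.  … We take random walk expansions for both operators, and in the difference all terms for walks with localizations
contained in Ω are cancelled. Remaining terms correspond to walks of the general type (3.107), for which at least one
localization X_i intersects Ωᶜ. Then the exponential factor in (3.108) gives the factor (3.154) (after adjusting a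
definition of δ₀).»  The characteristic inequalities of `G′` are (3.42) p. 397 = [4] (2.67): sup bounds for `G′λ`, `∇G′λ`,
`G′∇*λ`, `ΔG′λ` with the weights `(Lʲη)², Lʲη, Lʲη, 1` and the factor `e^{−δ₀d(y,y′)}`, `x ∈ Δ(y)`, `supp λ ⊂ Δ(y′)`.

## WHAT THIS FILE CERTIFIES (kernel-checked; lattice units `η = 1`; setting of file 1 `B9Thm314GpFlatTorusGeometry`)

At `U = 1` print's walk-expansion proof is replaced (declared) by the resolvent identity of file 1,
`G′[D] − G′[D′] = G′[D]·(Δ′[D′] − Δ′[D])·G′[D′]`, whose middle factor — the difference of the two (2.14) averaging terms —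
has its rows supported on `{lev_D ≠ lev_{D′}} ⊂ Ωᶜ` (print's cancellation of the walks inside `Ω`, file 1
`diffM_apply_of_lev_eq`).  This file proves the estimate of the resulting composite, GENERIC in two outer factors `A_L`,
`A_R` (so that file 3 obtains the entry (3.42)₁ with `A_L = A_R = 1` and the other sup entries with `A_L ∈ {∇_μ, Δ}`,
`A_R = ∇_μ*` from the same engine):
* §1 `abs_le_sum_of_hasMajorant` — a block-majorised operator on an arbitrary (not block-supported) vector:
  `|Tf(x)| ≤ Σ_b K(y(x), b)·U(b)` from the decomposition `f = Σ_b 1_b f` ([4] (2.51)).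
* §2 `abs_pert_le_Ublk` — if the inner vector obeys `|v(z)| ≤ C_R·L^{m·lev′z}·e^{−δd_{D′}(y′(z), y′)}·B` (the (2.67)-shape
  majorant of `G′[D′]·A_R` with weight exponent `m`), then `(Δ′[D′] − Δ′[D])v` vanishes on the `D`-blocks not meeting
  `{lev ≠ lev′}` and is bounded block-wise by `U(b) = a₊C_RB·(Ψ_m(b) + L^{−2j(b)}Φ_m(b))` (block maxima `PsiMax`, `PhiMax`
  of the inner profile; file 1 `abs_diffM_mulVec_le`); `transfer_top` — the (2.60) weight transfer on `T_η` in one family: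
  `(L^{2k}/L^{2j(s)})·e^{−¼δd(s,t)} ≤ L²` for a top block `t`, once `L² ≤ e^{¼δ(R·L·M_h − 1)}` (`levelSepTB`,
  `B6Ineq268.ratio_mul_exp_le`; [4] p. 235 «we may change it … using the exponential factor e^{−¼δ₀d(y,y′)} and the
  estimate (2.60)»); `block_term_le` — one surviving localisation costs
  `K_L·a₊C_RB·2L²e^{(3/2)δ}·(L^{mk}/L^{2k})·e^{−½δd(y,y′,Ω)}·e^{−¼δd_D(y,b)}` (the two scale mismatches between the level
  functions paid by `transfer_top` in either family, the factor `e^{−½δd(y,y′,Ω)}` by file 1 `dOmega_le_of_witness`);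
  **`resolvent_bound`** — summing over the blocks of `𝔅[D]` by (2.61) at the rate `¼δ` (`Ineq261With c`):
  `|((A_L·G′[D]·(Δ′[D′] − Δ′[D])·G′[D′]·A_R)λ)(x)| ≤ K_L(y)·(2C_Ra₊L²e^{(3/2)δ}c)·(L^{mk}/L^{2k})·e^{−½δ·d(y,y′,Ω)}·B`.

## HONEST SCOPE

* `U = 1` only, torus lineage of this seat (`Ω₁ = T_η`, levels `1 … k`, `A = 0`, `m² = 0`, lattice units, `P_μ ≥ 1` here),
  HYPOTHESIS-LEVEL in the majorants: this file assumes the block majorants of `A_L·G′[D]` and `G′[D′]·A_R` at ONE rate `δ`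
  and proves the domain-change estimate; the majorants are fed in (from the torus Prop. 2.2 lineage) in file 3.
* (3.154) as in file 1 (`dOmega`: `k`-block centres, torus sup-distance in units of `L^k`, `Ωᶜ` read on `k`-blocks,
  `inf ∅ := 0`).  A different (resolvent) proof of the printed statement on a model family, declared; nothing is inferred
  from the manuscript: every step is kernel-checked; the quoted sentences locate the statements.
-/

namespace Literature.MathematicalPhysics.QuantumFieldTheory.Balaban1983to89.B9Thm314GpFlatResolvent

open Finset Matrix
open Literature.MathematicalPhysics.QuantumFieldTheory.Balaban1983to89.B4Reflection242 (boxDom mem_boxDom blk avgK)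
open Literature.MathematicalPhysics.QuantumFieldTheory.Balaban1983to89.B6MultiLevelBoxOperator
open Literature.MathematicalPhysics.QuantumFieldTheory.Balaban1983to89.B6MultiLevelTorusOperator
open Literature.MathematicalPhysics.QuantumFieldTheory.Balaban1983to89.B6Geom246MultiLevelBox
open Literature.MathematicalPhysics.QuantumFieldTheory.Balaban1983to89.B6Geom246MultiLevelTorus
open Literature.MathematicalPhysics.QuantumFieldTheory.Balaban1983to89.B8Ineq192MultiLevelTorus (geomTB geomTB_dist
  geomTB_L geomTB_RM levelSepTB lenT_eq symmT)
open Literature.MathematicalPhysics.QuantumFieldTheory.Balaban1983to89.B6RandomWalk (HasMajorant BlockSupp blockPiece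
  sum_blockPiece hasMajorant_mono)
open Literature.MathematicalPhysics.QuantumFieldTheory.Balaban1983to89.B6Lemma21Repaired (Ineq261With)
open Literature.MathematicalPhysics.QuantumFieldTheory.Balaban1983to89.B6Ineq268 (mx LevelSep ratio ratio_mul_exp_le)
open Literature.MathematicalPhysics.QuantumFieldTheory.Balaban1983to89.B9Thm314GpFlatTorusGeometry

noncomputable section

variable {d : ℕ}

/-! ## §1 A majorised operator on arbitrary vectors: the block decomposition `Σ_{y″}Δ(y″) = I` -/

section BlockDecomp

variable {g : B6.Geometry} {X : Type}

/-- **`|(Tf)(x)| ≤ Σ_b K(y(x), b)·U(b)`** for a majorised operator `T` and ANY vector `f` with block-wise bounds `|f| ≤ U(b)`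
on `B(b)` (the decomposition `f = Σ_b Δ(b)f` of (2.52)). [cite: Balaban1984PropagatorsII, (2.51)–(2.52) p.232, (2.67) p.234] -/
theorem abs_le_sum_of_hasMajorant (blk : X → g.Site) {T : Module.End ℝ (X → ℝ)} {K : g.Site → g.Site → ℝ}
    (hT : HasMajorant blk T K) (f : X → ℝ) (U : g.Site → ℝ) (hU0 : ∀ b, 0 ≤ U b)
    (hU : ∀ z, |f z| ≤ U (blk z)) (x : X) : |T f x| ≤ ∑ b, K (blk x) b * U b := by
  classical
  have hf : f = ∑ b, blockPiece blk b f := (sum_blockPiece blk f).symm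
  have hpiece : ∀ b, BlockSupp blk (blockPiece blk b f) b (U b) := fun b =>
    { nonneg := hU0 b
      bound := fun z hz => by
        simp only [blockPiece, hz, if_true]
        exact hz ▸ hU z
      off := fun z hz => by simp only [blockPiece, hz, if_false] }
  have hTf : T f = ∑ b, T (blockPiece blk b f) := by
    conv_lhs => rw [hf]
    rw [map_sum]
  calc |T f x| = |(∑ b, T (blockPiece blk b f)) x| := by rw [hTf]
    _ = |∑ b, T (blockPiece blk b f) x| := by rw [Finset.sum_apply]
    _ ≤ ∑ b, |T (blockPiece blk b f) x| := Finset.abs_sum_le_sum_abs _ _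
    _ ≤ ∑ b, K (blk x) b * U b := Finset.sum_le_sum fun b _ => hT b _ _ (hpiece b) x

end BlockDecomp

/-! ## §2 The resolvent estimate (generic in the outer factors): the factor `e^{−½δ·d(y,y′,Ω)}` -/

section Resolvent

variable {ℓ Mh k R : ℕ} {P : Fin (d + 1) → ℕ} (D D' : TDomains d ℓ Mh k P R)

/-- a block of `𝔅[D]` which IS a block of `𝔅[D′]` (same level, same label) has the same sites in both families.
[cite: Balaban1984PropagatorsII, (2.45) p.231, dictionary] -/
theorem blkOf_eq_iff_blkOf_eq {p : ℕ × (Fin (d + 1) → ℤ)} (hp : p ∈ bset D.toDomains) (hp' : p ∈ bset D'.toDomains)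
    (x : ↥(boxDom (N0 ℓ Mh k P))) :
    blkOf D.toDomains x = ⟨p, hp⟩ ↔ blkOf D'.toDomains x = ⟨p, hp'⟩ := by
  rw [blkOf_eq_iff_blk D.toDomains, blkOf_eq_iff_blk D'.toDomains]

/-- the decay profile of the inner factor seen from the source block `y′` of `𝔅[D′]`: `E′(b′) = e^{−δ·d_{D′}(b′, y′)}`.
[cite: Balaban1984PropagatorsII, (2.67) p.234, dictionary] -/
def Eprof (δ : ℝ) (y' b' : ↥(bset D'.toDomains)) : ℝ := Real.exp (-(δ * (geomT D').dist b' y'))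

/-- `0 ≤ E′`. [cite: Balaban1984PropagatorsII, (2.67) p.234, dictionary] -/
theorem Eprof_nonneg (δ : ℝ) (y' b' : ↥(bset D'.toDomains)) : 0 ≤ Eprof D' δ y' b' := (Real.exp_pos _).le

/-- every block of `𝔅[D]` has a site (as a nonempty fibre of `y(·)`). [cite: Balaban1984PropagatorsII, (2.45) p.231, dictionary] -/
theorem fibre_nonempty (b : ↥(bset D.toDomains)) :
    (univ.filter fun z : ↥(boxDom (N0 ℓ Mh k P)) => blkOf D.toDomains z = b).Nonempty := by
  obtain ⟨z, hz⟩ := exists_blkOf_eq D.toDomains b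
  exact ⟨z, mem_filter.2 ⟨mem_univ _, hz⟩⟩

/-- `Φ_m(b) = max_{w ∈ B(b)} L^{m·lev′w}·E′(y^{D′}(w))` — the inner (2.67)-weight `(L^{j′}η)^m` (`m = 2, 1, 1, 0` for the entries
`G′, ∇G′, G′∇*, ΔG′`) of the OTHER family over the sites of the `D`-block `b`. [cite: Balaban1985BackgroundPropagators, Thm 3.14 p.427, (3.42) p.397, dictionary] -/
def PhiMax (m : ℕ) (δ : ℝ) (y' : ↥(bset D'.toDomains)) (b : ↥(bset D.toDomains)) : ℝ :=
  (univ.filter fun z : ↥(boxDom (N0 ℓ Mh k P)) => blkOf D.toDomains z = b).sup' (fibre_nonempty D b)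
    fun z => ((ℓ : ℝ) + 1) ^ (m * D'.lev z.1) * Eprof D' δ y' (blkOf D'.toDomains z)

/-- `Ψ_m(b) = max_{z ∈ B(b)} L^{−2lev′z}·L^{m·lev′z}·E′(y^{D′}(z))` (the inner weight after the `D′`-averaging term of the
perturbation). [cite: Balaban1985BackgroundPropagators, Thm 3.14 p.427, dictionary] -/
def PsiMax (m : ℕ) (δ : ℝ) (y' : ↥(bset D'.toDomains)) (b : ↥(bset D.toDomains)) : ℝ :=
  (univ.filter fun z : ↥(boxDom (N0 ℓ Mh k P)) => blkOf D.toDomains z = b).sup' (fibre_nonempty D b)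
    fun z => (((ℓ : ℝ) + 1) ^ (2 * D'.lev z.1))⁻¹ * (((ℓ : ℝ) + 1) ^ (m * D'.lev z.1) * Eprof D' δ y' (blkOf D'.toDomains z))

/-- `L^{m·lev′z}E′(y^{D′}(z)) ≤ Φ_m(y^{D}(z))`. [cite: Balaban1985BackgroundPropagators, Thm 3.14 p.427, dictionary] -/
theorem weight_Eprof_le_PhiMax (m : ℕ) (δ : ℝ) (y' : ↥(bset D'.toDomains)) (z : ↥(boxDom (N0 ℓ Mh k P))) :
    ((ℓ : ℝ) + 1) ^ (m * D'.lev z.1) * Eprof D' δ y' (blkOf D'.toDomains z) ≤ PhiMax D D' m δ y' (blkOf D.toDomains z) := by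
  unfold PhiMax
  exact Finset.le_sup' (fun w => ((ℓ : ℝ) + 1) ^ (m * D'.lev w.1) * Eprof D' δ y' (blkOf D'.toDomains w)) (by simp)

/-- `L^{−2lev′z}L^{m·lev′z}E′(y^{D′}(z)) ≤ Ψ_m(y^{D}(z))`. [cite: Balaban1985BackgroundPropagators, Thm 3.14 p.427, dictionary] -/
theorem weight_Eprof_le_PsiMax (m : ℕ) (δ : ℝ) (y' : ↥(bset D'.toDomains)) (z : ↥(boxDom (N0 ℓ Mh k P))) :
    (((ℓ : ℝ) + 1) ^ (2 * D'.lev z.1))⁻¹ * (((ℓ : ℝ) + 1) ^ (m * D'.lev z.1) * Eprof D' δ y' (blkOf D'.toDomains z))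
      ≤ PsiMax D D' m δ y' (blkOf D.toDomains z) := by
  unfold PsiMax
  exact Finset.le_sup' (fun w => (((ℓ : ℝ) + 1) ^ (2 * D'.lev w.1))⁻¹
    * (((ℓ : ℝ) + 1) ^ (m * D'.lev w.1) * Eprof D' δ y' (blkOf D'.toDomains w))) (by simp)

/-- `Φ_m ≥ 0`. [cite: Balaban1985BackgroundPropagators, Thm 3.14 p.427, dictionary] -/
theorem PhiMax_nonneg (m : ℕ) (δ : ℝ) (y' : ↥(bset D'.toDomains)) (b : ↥(bset D.toDomains)) :
    0 ≤ PhiMax D D' m δ y' b := by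
  obtain ⟨z, hz⟩ := exists_blkOf_eq D.toDomains b
  rw [← hz]
  exact le_trans (mul_nonneg (by positivity) (Eprof_nonneg D' δ y' _)) (weight_Eprof_le_PhiMax D D' m δ y' z)

/-- `Ψ_m ≥ 0`. [cite: Balaban1985BackgroundPropagators, Thm 3.14 p.427, dictionary] -/
theorem PsiMax_nonneg (m : ℕ) (δ : ℝ) (y' : ↥(bset D'.toDomains)) (b : ↥(bset D.toDomains)) :
    0 ≤ PsiMax D D' m δ y' b := by
  obtain ⟨z, hz⟩ := exists_blkOf_eq D.toDomains b
  rw [← hz]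
  exact le_trans (mul_nonneg (inv_nonneg.2 (by positivity)) (mul_nonneg (by positivity) (Eprof_nonneg D' δ y' _)))
    (weight_Eprof_le_PsiMax D D' m δ y' z)

/-- the `D`-block `b` MEETS `{lev_D ≠ lev_{D′}}` (⊂ Ωᶜ): the localisations that survive the cancellation.
[cite: Balaban1985BackgroundPropagators, Thm 3.14 p.427 («at least one localization X_i intersects Ωᶜ»)] -/
def Meets (b : ↥(bset D.toDomains)) : Prop :=
  ∃ z : ↥(boxDom (N0 ℓ Mh k P)), blkOf D.toDomains z = b ∧ D.lev z.1 ≠ D'.lev z.1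

open Classical in
/-- the block-wise bound of the perturbed vector: `U(b) = 1_{Meets b}·a₊C_RB·(Ψ_m(b) + L^{−2j(b)}Φ_m(b))`.
[cite: Balaban1985BackgroundPropagators, Thm 3.14 p.427, dictionary] -/
def Ublk (m : ℕ) (δ aplus CR B : ℝ) (y' : ↥(bset D'.toDomains)) (b : ↥(bset D.toDomains)) : ℝ :=
  if Meets D D' b then
    aplus * (CR * B) * (PsiMax D D' m δ y' b + (((ℓ : ℝ) + 1) ^ (2 * b.1.1))⁻¹ * PhiMax D D' m δ y' b)
  else 0

/-- `U ≥ 0` (for `a₊, C_R, B ≥ 0`). [cite: Balaban1985BackgroundPropagators, Thm 3.14 p.427, dictionary] -/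
theorem Ublk_nonneg (m : ℕ) {δ aplus CR B : ℝ} (hap : 0 ≤ aplus) (hCR : 0 ≤ CR) (hB : 0 ≤ B)
    (y' : ↥(bset D'.toDomains)) (b : ↥(bset D.toDomains)) : 0 ≤ Ublk D D' m δ aplus CR B y' b := by
  unfold Ublk
  split_ifs
  · have h1 := PsiMax_nonneg D D' m δ y' b
    have h2 : 0 ≤ (((ℓ : ℝ) + 1) ^ (2 * b.1.1))⁻¹ * PhiMax D D' m δ y' b :=
      mul_nonneg (inv_nonneg.2 (by positivity)) (PhiMax_nonneg D D' m δ y' b)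
    positivity
  · exact le_rfl

/-- **STEP 2 — THE PERTURBED VECTOR IS SUPPORTED ON THE BLOCKS MEETING `{lev ≠ lev′}` AND BLOCK-WISE BOUNDED BY `U`**:
if `|v(z)| ≤ C_R·L^{m·lev′z}·E′(y^{D′}(z))·B` (the (2.67) majorant of the inner factor), then
`|((Δ′[D′] − Δ′[D])v)(z)| ≤ U(y^D(z))`. [cite: Balaban1985BackgroundPropagators, Thm 3.14 p.427; Balaban1984PropagatorsII, (2.14) p.225] -/
theorem abs_pert_le_Ublk (m : ℕ) {a : ℕ → ℝ} {aplus : ℝ} (ha0 : ∀ j, 0 ≤ a j) (hap : ∀ j, a j ≤ aplus) {CR δ B : ℝ}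
    (hCR : 0 ≤ CR) (hB : 0 ≤ B) (y' : ↥(bset D'.toDomains)) {v : ↥(boxDom (N0 ℓ Mh k P)) → ℝ}
    (hv : ∀ z, |v z| ≤ CR * ((ℓ : ℝ) + 1) ^ (m * D'.lev z.1) * Eprof D' δ y' (blkOf D'.toDomains z) * B)
    (z : ↥(boxDom (N0 ℓ Mh k P))) :
    |(diffM D D' a *ᵥ v) z| ≤ Ublk D D' m δ aplus CR B y' (blkOf D.toDomains z) := by
  classical
  have hap0 : 0 ≤ aplus := (ha0 0).trans (hap 0)
  by_cases hzl : D.lev z.1 = D'.lev z.1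
  · have h0 : (diffM D D' a *ᵥ v) z = 0 := by
      simp only [Matrix.mulVec, dotProduct, diffM_apply_of_lev_eq D D' a hzl, zero_mul, Finset.sum_const_zero]
    rw [h0, abs_zero]
    exact Ublk_nonneg D D' m hap0 hCR hB y' _
  · have hmeets : Meets D D' (blkOf D.toDomains z) := ⟨z, rfl, hzl⟩
    unfold Ublk
    rw [if_pos hmeets]
    -- the two block bounds for `v` around `z`
    have hF' : ∀ w, blkOf D'.toDomains w = blkOf D'.toDomains z →
        |v w| ≤ CR * ((ℓ : ℝ) + 1) ^ (m * D'.lev z.1) * Eprof D' δ y' (blkOf D'.toDomains z) * B := by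
      intro w hw
      have hlw : D'.lev w.1 = D'.lev z.1 := by
        have h := lev_eq_of_blkOf_eq D'.toDomains hw
        rw [TDomains.toDomains_lev] at h
        exact h
      have h := hv w
      rw [hw, hlw] at h
      exact h
    have hF : ∀ w, blkOf D.toDomains w = blkOf D.toDomains z →
        |v w| ≤ CR * PhiMax D D' m δ y' (blkOf D.toDomains z) * B := by
      intro w hw
      calc |v w| ≤ CR * ((ℓ : ℝ) + 1) ^ (m * D'.lev w.1) * Eprof D' δ y' (blkOf D'.toDomains w) * B := hv w
        _ = CR * (((ℓ : ℝ) + 1) ^ (m * D'.lev w.1) * Eprof D' δ y' (blkOf D'.toDomains w)) * B := by ring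
        _ ≤ CR * PhiMax D D' m δ y' (blkOf D.toDomains z) * B := by
            refine mul_le_mul_of_nonneg_right (mul_le_mul_of_nonneg_left ?_ hCR) hB
            rw [← hw]; exact weight_Eprof_le_PhiMax D D' m δ y' w
    refine (abs_diffM_mulVec_le D D' a ha0 v z hF hF').trans ?_
    have e1 : a (D'.lev z.1) * ((((ℓ : ℝ) + 1) ^ D'.lev z.1) ^ 2)⁻¹
          * (CR * ((ℓ : ℝ) + 1) ^ (m * D'.lev z.1) * Eprof D' δ y' (blkOf D'.toDomains z) * B)
        = a (D'.lev z.1) * (CR * B) * ((((ℓ : ℝ) + 1) ^ (2 * D'.lev z.1))⁻¹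
          * (((ℓ : ℝ) + 1) ^ (m * D'.lev z.1) * Eprof D' δ y' (blkOf D'.toDomains z))) := by
      rw [← pow_mul, mul_comm (D'.lev z.1) 2]; ring
    have hlevz : (blkOf D.toDomains z).1.1 = D.lev z.1 := rfl
    rw [e1, hlevz]
    have hΨz := weight_Eprof_le_PsiMax D D' m δ y' z
    have hΨ0 : 0 ≤ (((ℓ : ℝ) + 1) ^ (2 * D'.lev z.1))⁻¹
        * (((ℓ : ℝ) + 1) ^ (m * D'.lev z.1) * Eprof D' δ y' (blkOf D'.toDomains z)) :=
      mul_nonneg (inv_nonneg.2 (by positivity)) (mul_nonneg (by positivity) (Eprof_nonneg D' δ y' _))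
    have t1 : a (D'.lev z.1) * (CR * B) * ((((ℓ : ℝ) + 1) ^ (2 * D'.lev z.1))⁻¹
          * (((ℓ : ℝ) + 1) ^ (m * D'.lev z.1) * Eprof D' δ y' (blkOf D'.toDomains z)))
        ≤ aplus * (CR * B) * PsiMax D D' m δ y' (blkOf D.toDomains z) :=
      mul_le_mul (mul_le_mul_of_nonneg_right (hap _) (mul_nonneg hCR hB)) hΨz hΨ0 (by positivity)
    have h0 : 0 ≤ (((ℓ : ℝ) + 1) ^ (2 * D.lev z.1))⁻¹ * (CR * PhiMax D D' m δ y' (blkOf D.toDomains z) * B) :=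
      mul_nonneg (inv_nonneg.2 (by positivity))
        (by have := PhiMax_nonneg D D' m δ y' (blkOf D.toDomains z); positivity)
    have t2 : a (D.lev z.1) * ((((ℓ : ℝ) + 1) ^ D.lev z.1) ^ 2)⁻¹ * (CR * PhiMax D D' m δ y' (blkOf D.toDomains z) * B)
        ≤ aplus * (CR * B) * ((((ℓ : ℝ) + 1) ^ (2 * D.lev z.1))⁻¹ * PhiMax D D' m δ y' (blkOf D.toDomains z)) := by
      rw [← pow_mul, mul_comm (D.lev z.1) 2]
      calc a (D.lev z.1) * (((ℓ : ℝ) + 1) ^ (2 * D.lev z.1))⁻¹ * (CR * PhiMax D D' m δ y' (blkOf D.toDomains z) * B)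
          = a (D.lev z.1) * ((((ℓ : ℝ) + 1) ^ (2 * D.lev z.1))⁻¹ * (CR * PhiMax D D' m δ y' (blkOf D.toDomains z) * B)) := by
            ring
        _ ≤ aplus * ((((ℓ : ℝ) + 1) ^ (2 * D.lev z.1))⁻¹ * (CR * PhiMax D D' m δ y' (blkOf D.toDomains z) * B)) :=
            mul_le_mul_of_nonneg_right (hap _) h0
        _ = aplus * (CR * B) * ((((ℓ : ℝ) + 1) ^ (2 * D.lev z.1))⁻¹ * PhiMax D D' m δ y' (blkOf D.toDomains z)) := by
            ring
    calc _ ≤ aplus * (CR * B) * PsiMax D D' m δ y' (blkOf D.toDomains z)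
          + aplus * (CR * B) * ((((ℓ : ℝ) + 1) ^ (2 * D.lev z.1))⁻¹ * PhiMax D D' m δ y' (blkOf D.toDomains z)) :=
        add_le_add t1 t2
      _ = aplus * (CR * B) * (PsiMax D D' m δ y' (blkOf D.toDomains z)
          + (((ℓ : ℝ) + 1) ^ (2 * D.lev z.1))⁻¹ * PhiMax D D' m δ y' (blkOf D.toDomains z)) := by ring

/-- the weight transfer (2.60) in ONE family: for a top block `t` and any block `s`,
`(L^{2k}/L^{2j(s)})·e^{−¼δ·d(s, t)} ≤ L²` once `L² ≤ e^{¼δ(R·L·M_h − 1)}` («the choice of powers … is purely conventional and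
we may change it … using the exponential factor e^{−¼δ₀d(y,y′)} and the estimate (2.60)», [4] p.235). [cite: Balaban1984PropagatorsII, p.235, (2.60) p.234] -/
theorem transfer_top (D₀ : TDomains d ℓ Mh k P R) (hMh : 1 ≤ Mh) (hP : ∀ μ, 1 ≤ P μ)
    (hRM : 1 ≤ R * ((ℓ + 1) * Mh)) {δ : ℝ} (hδ : 0 ≤ δ)
    (hthr : ((ℓ : ℝ) + 1) ^ 2 ≤ Real.exp (1 / 4 * δ * ((R : ℝ) * (((ℓ : ℝ) + 1) * Mh) - 1)))
    (s t : ↥(bset D₀.toDomains)) (ht : t.1.1 = k) :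
    ((ℓ : ℝ) + 1) ^ (2 * k) / ((ℓ : ℝ) + 1) ^ (2 * s.1.1) * Real.exp (-(1 / 4 * δ * (geomT D₀).dist s t))
      ≤ ((ℓ : ℝ) + 1) ^ 2 := by
  have hL1 : (1 : ℝ) ≤ (ℓ : ℝ) + 1 := by linarith [(Nat.cast_nonneg ℓ : (0 : ℝ) ≤ ℓ)]
  have hsep : LevelSep (geomTB D₀) := levelSepTB D₀ hMh hP hRM
  have hRM0 : 0 ≤ (R : ℝ) * (((ℓ : ℝ) + 1) * Mh) - 1 := by
    have : (1 : ℝ) ≤ (R : ℝ) * (((ℓ : ℝ) + 1) * Mh) := by exact_mod_cast hRM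
    linarith
  have hβ0 : 0 ≤ 1 / 4 * δ * ((R : ℝ) * (((ℓ : ℝ) + 1) * Mh) - 1) := mul_nonneg (by positivity) hRM0
  have hmx : 1 / 4 * δ * ((R : ℝ) * (((ℓ : ℝ) + 1) * Mh) - 1) * mx (geomTB D₀) s t
      ≤ 1 / 4 * δ * (geomT D₀).dist s t := by
    have h := hsep s t
    rw [geomTB_RM D₀ hMh, geomTB_dist] at h
    calc 1 / 4 * δ * ((R : ℝ) * (((ℓ : ℝ) + 1) * Mh) - 1) * mx (geomTB D₀) s t
        = 1 / 4 * δ * (((R : ℝ) * (((ℓ : ℝ) + 1) * Mh) - 1) * mx (geomTB D₀) s t) := by ring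
      _ ≤ 1 / 4 * δ * (geomT D₀).dist s t := mul_le_mul_of_nonneg_left h (by positivity)
  have h1 := ratio_mul_exp_le (g := geomTB D₀) (by rw [geomTB_L]; exact hL1)
    (β := 1 / 4 * δ * ((R : ℝ) * (((ℓ : ℝ) + 1) * Mh) - 1)) hβ0 (by rw [geomTB_L]; exact hthr) s t
  have hratio : ratio (geomTB D₀) s t = ((ℓ : ℝ) + 1) ^ (2 * k) / ((ℓ : ℝ) + 1) ^ (2 * s.1.1) := by
    unfold ratio; rw [geomTB_L]; show ((ℓ : ℝ) + 1) ^ (2 * t.1.1) / ((ℓ : ℝ) + 1) ^ (2 * s.1.1) = _; rw [ht]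
  rw [geomTB_L, hratio] at h1
  calc ((ℓ : ℝ) + 1) ^ (2 * k) / ((ℓ : ℝ) + 1) ^ (2 * s.1.1) * Real.exp (-(1 / 4 * δ * (geomT D₀).dist s t))
      ≤ ((ℓ : ℝ) + 1) ^ (2 * k) / ((ℓ : ℝ) + 1) ^ (2 * s.1.1)
        * Real.exp (-(1 / 4 * δ * ((R : ℝ) * (((ℓ : ℝ) + 1) * Mh) - 1) * mx (geomTB D₀) s t)) :=
        mul_le_mul_of_nonneg_left (Real.exp_le_exp.2 (by linarith)) (by positivity)
    _ ≤ ((ℓ : ℝ) + 1) ^ 2 := h1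

/-- **STEP 4 — ONE SURVIVING LOCALISATION**: for a `D`-block `b`, a top block `y` of `𝔅[D]` and a top block `y′` of `𝔅[D′]`,
`K_L·e^{−δd(y,b)}·U(b) ≤ K_L·a₊C_RB·2L²e^{(3/2)δ}·(L^{mk}/L^{2k})·e^{−½δ·d(y,y′,Ω)}·e^{−¼δd(y,b)}` — the scale mismatches
between the two level functions cost `L²` and a quarter of the rate through (2.60) in either family (`transfer_top`),
another quarter + the inner decay give `e^{−½δd(y,y′,Ω)}` through file 1's `dOmega_le_of_witness`.
[cite: Balaban1985BackgroundPropagators, Thm 3.14 (3.154) p.427; Balaban1984PropagatorsII, (2.60) p.234, p.235] -/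
theorem block_term_le (hMh : 1 ≤ Mh) (hP : ∀ μ, 1 ≤ P μ) (hRM : 1 ≤ R * ((ℓ + 1) * Mh)) (m : ℕ)
    {KL aplus CR δ B : ℝ} (hKL : 0 ≤ KL) (hap : 0 ≤ aplus) (hCR : 0 ≤ CR) (hδ : 0 ≤ δ) (hB : 0 ≤ B)
    (hthr : ((ℓ : ℝ) + 1) ^ 2 ≤ Real.exp (1 / 4 * δ * ((R : ℝ) * (((ℓ : ℝ) + 1) * Mh) - 1)))
    {y : ↥(bset D.toDomains)} (hy : y.1.1 = k) {y' : ↥(bset D'.toDomains)} (hy' : y'.1.1 = k)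
    (b : ↥(bset D.toDomains)) :
    KL * Real.exp (-(δ * (geomT D).dist y b)) * Ublk D D' m δ aplus CR B y' b
      ≤ KL * (aplus * (CR * B))
          * (2 * ((ℓ : ℝ) + 1) ^ 2 * Real.exp (3 / 2 * δ) * (((ℓ : ℝ) + 1) ^ (m * k) / ((ℓ : ℝ) + 1) ^ (2 * k))
            * Real.exp (-(1 / 2 * δ * dOmega D D' y.1.2 y'.1.2)))
        * Real.exp (-(1 / 4 * δ * (geomT D).dist y b)) := by
  classical
  have hL1 : (1 : ℝ) ≤ (ℓ : ℝ) + 1 := by linarith [(Nat.cast_nonneg ℓ : (0 : ℝ) ≤ ℓ)]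
  have hL0 : (0 : ℝ) < (ℓ : ℝ) + 1 := by positivity
  have hd0 : ∀ s t : ↥(bset D.toDomains), 0 ≤ (geomT D).dist s t := (triangle_refl_nonneg_T D hMh hP).2.2
  have hd0' : ∀ s t : ↥(bset D'.toDomains), 0 ≤ (geomT D').dist s t := (triangle_refl_nonneg_T D' hMh hP).2.2
  by_cases hmeets : Meets D D' b
  · obtain ⟨zb, hzb, hzbl⟩ := hmeets
    unfold Ublk
    rw [if_pos ⟨zb, hzb, hzbl⟩]
    -- realise the two maxima
    obtain ⟨z₁, hz₁m, hz₁⟩ := Finset.exists_mem_eq_sup' (fibre_nonempty D b)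
      fun z => (((ℓ : ℝ) + 1) ^ (2 * D'.lev z.1))⁻¹ * (((ℓ : ℝ) + 1) ^ (m * D'.lev z.1) * Eprof D' δ y' (blkOf D'.toDomains z))
    obtain ⟨w₁, hw₁m, hw₁⟩ := Finset.exists_mem_eq_sup' (fibre_nonempty D b)
      fun z => ((ℓ : ℝ) + 1) ^ (m * D'.lev z.1) * Eprof D' δ y' (blkOf D'.toDomains z)
    have hz₁b : blkOf D.toDomains z₁ = b := (mem_filter.1 hz₁m).2
    have hw₁b : blkOf D.toDomains w₁ = b := (mem_filter.1 hw₁m).2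
    have eΨ : PsiMax D D' m δ y' b = (((ℓ : ℝ) + 1) ^ (2 * D'.lev z₁.1))⁻¹
        * (((ℓ : ℝ) + 1) ^ (m * D'.lev z₁.1) * Eprof D' δ y' (blkOf D'.toDomains z₁)) := hz₁
    have eΦ : PhiMax D D' m δ y' b = ((ℓ : ℝ) + 1) ^ (m * D'.lev w₁.1) * Eprof D' δ y' (blkOf D'.toDomains w₁) := hw₁
    -- the (3.154) witnesses
    have hΩ₁ := dOmega_le_of_witness D D' hMh hP hy hy' hzb hz₁b hzbl
    have hΩ₂ := dOmega_le_of_witness D D' hMh hP hy hy' hzb hw₁b hzbl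
    -- common abbreviation of the target shape
    have hpow2k : (0 : ℝ) < ((ℓ : ℝ) + 1) ^ (2 * k) := by positivity
    -- (i) the `Ψ`-term: mismatch `L^{(2−m)(k − lev′z₁)}` paid in the family `D′`
    have hlz : D'.lev z₁.1 ≤ k := D'.lev_le _
    have hratio₁ : (((ℓ : ℝ) + 1) ^ (2 * D'.lev z₁.1))⁻¹ * ((ℓ : ℝ) + 1) ^ (m * D'.lev z₁.1)
        ≤ ((ℓ : ℝ) + 1) ^ (m * k) / ((ℓ : ℝ) + 1) ^ (2 * k)
          * (((ℓ : ℝ) + 1) ^ (2 * k) / ((ℓ : ℝ) + 1) ^ (2 * (blkOf D'.toDomains z₁).1.1)) := by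
      have e : (blkOf D'.toDomains z₁).1.1 = D'.lev z₁.1 := rfl
      rw [e, div_mul_div_comm, mul_comm (((ℓ : ℝ) + 1) ^ (m * k)), ← div_mul_div_comm, div_self hpow2k.ne', one_mul,
        div_eq_mul_inv, mul_comm]
      exact mul_le_mul_of_nonneg_right (pow_le_pow_right₀ hL1 (Nat.mul_le_mul_left m hlz)) (inv_nonneg.2 (pow_nonneg hL0.le _))
    have htr₁ := transfer_top D' hMh hP hRM hδ hthr (blkOf D'.toDomains z₁) y' hy'
    have hi : Real.exp (-(δ * (geomT D).dist y b))
          * ((((ℓ : ℝ) + 1) ^ (2 * D'.lev z₁.1))⁻¹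
            * (((ℓ : ℝ) + 1) ^ (m * D'.lev z₁.1) * Eprof D' δ y' (blkOf D'.toDomains z₁)))
        ≤ ((ℓ : ℝ) + 1) ^ (m * k) / ((ℓ : ℝ) + 1) ^ (2 * k) * ((ℓ : ℝ) + 1) ^ 2
          * (Real.exp (3 / 2 * δ) * Real.exp (-(1 / 2 * δ * dOmega D D' y.1.2 y'.1.2))
            * Real.exp (-(1 / 4 * δ * (geomT D).dist y b))) := by
      have hsplit : Eprof D' δ y' (blkOf D'.toDomains z₁)
          = Real.exp (-(1 / 4 * δ * (geomT D').dist (blkOf D'.toDomains z₁) y'))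
            * Real.exp (-(3 / 4 * δ * (geomT D').dist (blkOf D'.toDomains z₁) y')) := by
        unfold Eprof; rw [← Real.exp_add]; congr 1; ring
      have hrest : Real.exp (-(δ * (geomT D).dist y b))
          * Real.exp (-(3 / 4 * δ * (geomT D').dist (blkOf D'.toDomains z₁) y'))
          ≤ Real.exp (3 / 2 * δ) * Real.exp (-(1 / 2 * δ * dOmega D D' y.1.2 y'.1.2))
            * Real.exp (-(1 / 4 * δ * (geomT D).dist y b)) := by
        rw [← Real.exp_add, ← Real.exp_add, ← Real.exp_add, Real.exp_le_exp]
        have := hd0' (blkOf D'.toDomains z₁) y'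
        have := hd0 y b
        nlinarith
      have hA : (((ℓ : ℝ) + 1) ^ (2 * D'.lev z₁.1))⁻¹ * ((ℓ : ℝ) + 1) ^ (m * D'.lev z₁.1)
          * Real.exp (-(1 / 4 * δ * (geomT D').dist (blkOf D'.toDomains z₁) y'))
          ≤ ((ℓ : ℝ) + 1) ^ (m * k) / ((ℓ : ℝ) + 1) ^ (2 * k) * ((ℓ : ℝ) + 1) ^ 2 := by
        calc _ ≤ ((ℓ : ℝ) + 1) ^ (m * k) / ((ℓ : ℝ) + 1) ^ (2 * k)
              * (((ℓ : ℝ) + 1) ^ (2 * k) / ((ℓ : ℝ) + 1) ^ (2 * (blkOf D'.toDomains z₁).1.1)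
                * Real.exp (-(1 / 4 * δ * (geomT D').dist (blkOf D'.toDomains z₁) y'))) := by
              rw [← mul_assoc]
              exact mul_le_mul_of_nonneg_right hratio₁ (Real.exp_pos _).le
          _ ≤ ((ℓ : ℝ) + 1) ^ (m * k) / ((ℓ : ℝ) + 1) ^ (2 * k) * ((ℓ : ℝ) + 1) ^ 2 :=
              mul_le_mul_of_nonneg_left htr₁ (by positivity)
      calc Real.exp (-(δ * (geomT D).dist y b))
            * ((((ℓ : ℝ) + 1) ^ (2 * D'.lev z₁.1))⁻¹
              * (((ℓ : ℝ) + 1) ^ (m * D'.lev z₁.1) * Eprof D' δ y' (blkOf D'.toDomains z₁)))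
          = ((((ℓ : ℝ) + 1) ^ (2 * D'.lev z₁.1))⁻¹ * ((ℓ : ℝ) + 1) ^ (m * D'.lev z₁.1)
              * Real.exp (-(1 / 4 * δ * (geomT D').dist (blkOf D'.toDomains z₁) y')))
            * (Real.exp (-(δ * (geomT D).dist y b))
              * Real.exp (-(3 / 4 * δ * (geomT D').dist (blkOf D'.toDomains z₁) y'))) := by rw [hsplit]; ring
        _ ≤ _ := mul_le_mul hA hrest (by positivity) (by positivity)
    -- (ii) the `Φ`-term: mismatch `L^{2(k − j(b))}` paid in the family `D`
    have hlw : D'.lev w₁.1 ≤ k := D'.lev_le _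
    have hratio₂ : (((ℓ : ℝ) + 1) ^ (2 * b.1.1))⁻¹ * ((ℓ : ℝ) + 1) ^ (m * D'.lev w₁.1)
        ≤ ((ℓ : ℝ) + 1) ^ (m * k) / ((ℓ : ℝ) + 1) ^ (2 * k)
          * (((ℓ : ℝ) + 1) ^ (2 * k) / ((ℓ : ℝ) + 1) ^ (2 * b.1.1)) := by
      rw [div_mul_div_comm, mul_comm (((ℓ : ℝ) + 1) ^ (m * k)), ← div_mul_div_comm, div_self hpow2k.ne', one_mul,
        div_eq_mul_inv, mul_comm]
      exact mul_le_mul_of_nonneg_right (pow_le_pow_right₀ hL1 (Nat.mul_le_mul_left m hlw)) (inv_nonneg.2 (pow_nonneg hL0.le _))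
    have htr₂ := transfer_top D hMh hP hRM hδ hthr b y hy
    have hii : Real.exp (-(δ * (geomT D).dist y b))
          * ((((ℓ : ℝ) + 1) ^ (2 * b.1.1))⁻¹ * (((ℓ : ℝ) + 1) ^ (m * D'.lev w₁.1) * Eprof D' δ y' (blkOf D'.toDomains w₁)))
        ≤ ((ℓ : ℝ) + 1) ^ (m * k) / ((ℓ : ℝ) + 1) ^ (2 * k) * ((ℓ : ℝ) + 1) ^ 2
          * (Real.exp (3 / 2 * δ) * Real.exp (-(1 / 2 * δ * dOmega D D' y.1.2 y'.1.2))
            * Real.exp (-(1 / 4 * δ * (geomT D).dist y b))) := by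
      have hsplit : Real.exp (-(δ * (geomT D).dist y b))
          = Real.exp (-(1 / 4 * δ * (geomT D).dist y b)) * Real.exp (-(3 / 4 * δ * (geomT D).dist y b)) := by
        rw [← Real.exp_add]; congr 1; ring
      have hrest : Real.exp (-(3 / 4 * δ * (geomT D).dist y b)) * Eprof D' δ y' (blkOf D'.toDomains w₁)
          ≤ Real.exp (3 / 2 * δ) * Real.exp (-(1 / 2 * δ * dOmega D D' y.1.2 y'.1.2))
            * Real.exp (-(1 / 4 * δ * (geomT D).dist y b)) := by
        unfold Eprof
        rw [← Real.exp_add, ← Real.exp_add, ← Real.exp_add, Real.exp_le_exp]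
        have := hd0' (blkOf D'.toDomains w₁) y'
        have := hd0 y b
        nlinarith
      have hA : (((ℓ : ℝ) + 1) ^ (2 * b.1.1))⁻¹ * ((ℓ : ℝ) + 1) ^ (m * D'.lev w₁.1)
          * Real.exp (-(1 / 4 * δ * (geomT D).dist y b))
          ≤ ((ℓ : ℝ) + 1) ^ (m * k) / ((ℓ : ℝ) + 1) ^ (2 * k) * ((ℓ : ℝ) + 1) ^ 2 := by
        have hsymm : (geomT D).dist y b = (geomT D).dist b y := symmT D y b
        calc _ ≤ ((ℓ : ℝ) + 1) ^ (m * k) / ((ℓ : ℝ) + 1) ^ (2 * k)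
              * (((ℓ : ℝ) + 1) ^ (2 * k) / ((ℓ : ℝ) + 1) ^ (2 * b.1.1)
                * Real.exp (-(1 / 4 * δ * (geomT D).dist b y))) := by
              rw [← mul_assoc, hsymm]
              exact mul_le_mul_of_nonneg_right hratio₂ (Real.exp_pos _).le
          _ ≤ ((ℓ : ℝ) + 1) ^ (m * k) / ((ℓ : ℝ) + 1) ^ (2 * k) * ((ℓ : ℝ) + 1) ^ 2 :=
              mul_le_mul_of_nonneg_left htr₂ (by positivity)
      calc Real.exp (-(δ * (geomT D).dist y b))
            * ((((ℓ : ℝ) + 1) ^ (2 * b.1.1))⁻¹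
              * (((ℓ : ℝ) + 1) ^ (m * D'.lev w₁.1) * Eprof D' δ y' (blkOf D'.toDomains w₁)))
          = ((((ℓ : ℝ) + 1) ^ (2 * b.1.1))⁻¹ * ((ℓ : ℝ) + 1) ^ (m * D'.lev w₁.1)
              * Real.exp (-(1 / 4 * δ * (geomT D).dist y b)))
            * (Real.exp (-(3 / 4 * δ * (geomT D).dist y b)) * Eprof D' δ y' (blkOf D'.toDomains w₁)) := by
            rw [hsplit]; ring
        _ ≤ _ := mul_le_mul hA hrest (mul_nonneg (Real.exp_pos _).le (Eprof_nonneg D' δ y' _)) (by positivity)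
    -- assemble the block term
    rw [eΨ, eΦ]
    have hpre : 0 ≤ KL * (aplus * (CR * B)) := by positivity
    calc KL * Real.exp (-(δ * (geomT D).dist y b))
          * (aplus * (CR * B) * ((((ℓ : ℝ) + 1) ^ (2 * D'.lev z₁.1))⁻¹
              * (((ℓ : ℝ) + 1) ^ (m * D'.lev z₁.1) * Eprof D' δ y' (blkOf D'.toDomains z₁))
            + (((ℓ : ℝ) + 1) ^ (2 * b.1.1))⁻¹
              * (((ℓ : ℝ) + 1) ^ (m * D'.lev w₁.1) * Eprof D' δ y' (blkOf D'.toDomains w₁))))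
        = KL * (aplus * (CR * B))
            * (Real.exp (-(δ * (geomT D).dist y b))
                * ((((ℓ : ℝ) + 1) ^ (2 * D'.lev z₁.1))⁻¹
                  * (((ℓ : ℝ) + 1) ^ (m * D'.lev z₁.1) * Eprof D' δ y' (blkOf D'.toDomains z₁)))
              + Real.exp (-(δ * (geomT D).dist y b))
                * ((((ℓ : ℝ) + 1) ^ (2 * b.1.1))⁻¹
                  * (((ℓ : ℝ) + 1) ^ (m * D'.lev w₁.1) * Eprof D' δ y' (blkOf D'.toDomains w₁)))) := by ring
      _ ≤ KL * (aplus * (CR * B))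
            * (((ℓ : ℝ) + 1) ^ (m * k) / ((ℓ : ℝ) + 1) ^ (2 * k) * ((ℓ : ℝ) + 1) ^ 2
                * (Real.exp (3 / 2 * δ) * Real.exp (-(1 / 2 * δ * dOmega D D' y.1.2 y'.1.2))
                  * Real.exp (-(1 / 4 * δ * (geomT D).dist y b)))
              + ((ℓ : ℝ) + 1) ^ (m * k) / ((ℓ : ℝ) + 1) ^ (2 * k) * ((ℓ : ℝ) + 1) ^ 2
                * (Real.exp (3 / 2 * δ) * Real.exp (-(1 / 2 * δ * dOmega D D' y.1.2 y'.1.2))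
                  * Real.exp (-(1 / 4 * δ * (geomT D).dist y b)))) :=
          mul_le_mul_of_nonneg_left (add_le_add hi hii) hpre
      _ = _ := by ring
  · unfold Ublk
    rw [if_neg hmeets, mul_zero]
    positivity

/-- **THE RESOLVENT ESTIMATE (generic outer factors).**  HYPOTHESES: the block majorant of the LEFT composite `A_L·G′[D]`
on `𝔅[D]` with the row weight `K_L(y)` and rate `δ`; the block majorant of the INNER composite `G′[D′]·A_R` on `𝔅[D′]` with
weight `C_R·L^{m·j}` and the same rate; weights `0 ≤ a_j ≤ a₊`, positive at levels `≥ 1`; (2.61) on `𝔅[D]` at the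
rate `¼δ` with constant `c`; the (2.60)-threshold `L² ≤ e^{¼δ(R·L·M_h − 1)}`.  CONCLUSION: for top blocks `y` of `𝔅[D]`,
`y′` of `𝔅[D′]`, `supp λ ⊂ B^k(y′)`, `|λ| ≤ B`, `x ∈ B^k(y)`:
`|((A_L·G′[D]·(Δ′[D′] − Δ′[D])·G′[D′]·A_R)λ)(x)| ≤ K_L(y)·(2C_Ra₊L²e^{(3/2)δ}c)·(L^{mk}/L^{2k})·e^{−½δ·d(y,y′,Ω)}·B`.
[cite: Balaban1985BackgroundPropagators, Thm 3.14 (3.154) pp.426–427; Balaban1984PropagatorsII, (2.67) p.234, (2.60)–(2.61) p.234, p.235] -/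
theorem resolvent_bound (hMh : 1 ≤ Mh) (hP : ∀ μ, 1 ≤ P μ) (hRM : 1 ≤ R * ((ℓ + 1) * Mh))
    {a : ℕ → ℝ} {aplus : ℝ} (ha0 : ∀ j, 0 ≤ a j) (hap : ∀ j, a j ≤ aplus) (m : ℕ)
    (AL AR : Matrix ↥(boxDom (N0 ℓ Mh k P)) ↥(boxDom (N0 ℓ Mh k P)) ℝ) {KL : ↥(bset D.toDomains) → ℝ}
    {CR δ c : ℝ} (hCR : 0 ≤ CR) (hδ : 0 ≤ δ)
    (hL : HasMajorant (g := geomT D) (blkOf D.toDomains) (Matrix.toLin' (AL * gmlT (N0 ℓ Mh k P) ℓ k D.lev a))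
      (fun y y' => KL y * Real.exp (-(δ * (geomT D).dist y y'))))
    (hR : HasMajorant (g := geomT D') (blkOf D'.toDomains) (Matrix.toLin' (gmlT (N0 ℓ Mh k P) ℓ k D'.lev a * AR))
      (fun y y' => CR * ((ℓ : ℝ) + 1) ^ (m * y.1.1) * Real.exp (-(δ * (geomT D').dist y y'))))
    (h261 : Ineq261With c (geomT D) δ (1 / 4))
    (hthr : ((ℓ : ℝ) + 1) ^ 2 ≤ Real.exp (1 / 4 * δ * ((R : ℝ) * (((ℓ : ℝ) + 1) * Mh) - 1)))
    {y : ↥(bset D.toDomains)} (hy : y.1.1 = k) (hKL : 0 ≤ KL y) {y' : ↥(bset D'.toDomains)} (hy' : y'.1.1 = k)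
    {μv : ↥(boxDom (N0 ℓ Mh k P)) → ℝ} {B : ℝ} (hμ : BlockSupp (g := geomT D') (blkOf D'.toDomains) μv y' B)
    {x : ↥(boxDom (N0 ℓ Mh k P))} (hx : blkOf D.toDomains x = y) :
    |((AL * gmlT (N0 ℓ Mh k P) ℓ k D.lev a * diffM D D' a * gmlT (N0 ℓ Mh k P) ℓ k D'.lev a * AR) *ᵥ μv) x|
      ≤ KL y * (2 * CR * aplus * ((ℓ : ℝ) + 1) ^ 2 * Real.exp (3 / 2 * δ) * c)
        * (((ℓ : ℝ) + 1) ^ (m * k) / ((ℓ : ℝ) + 1) ^ (2 * k))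
        * Real.exp (-(1 / 2 * δ * dOmega D D' y.1.2 y'.1.2)) * B := by
  classical
  have hB : 0 ≤ B := hμ.nonneg
  have hap0 : 0 ≤ aplus := (ha0 0).trans (hap 0)
  -- STEP 1: the inner vector and its (2.67) majorant
  have hvz : ∀ z, |((gmlT (N0 ℓ Mh k P) ℓ k D'.lev a * AR) *ᵥ μv) z|
      ≤ CR * ((ℓ : ℝ) + 1) ^ (m * D'.lev z.1) * Eprof D' δ y' (blkOf D'.toDomains z) * B := by
    intro z
    have h := hR y' μv B hμ z
    rw [Matrix.toLin'_apply] at h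
    exact h
  -- STEP 2: the perturbed vector
  have huz := abs_pert_le_Ublk D D' m ha0 hap hCR hB y' hvz
  -- STEP 3: the outer factor by the block decomposition
  have hGux := abs_le_sum_of_hasMajorant (g := geomT D) (blkOf D.toDomains) hL
    (diffM D D' a *ᵥ ((gmlT (N0 ℓ Mh k P) ℓ k D'.lev a * AR) *ᵥ μv)) (Ublk D D' m δ aplus CR B y')
    (Ublk_nonneg D D' m hap0 hCR hB y') huz x
  rw [Matrix.toLin'_apply, hx] at hGux
  have hident : ((AL * gmlT (N0 ℓ Mh k P) ℓ k D.lev a * diffM D D' a * gmlT (N0 ℓ Mh k P) ℓ k D'.lev a * AR) *ᵥ μv) x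
      = ((AL * gmlT (N0 ℓ Mh k P) ℓ k D.lev a)
          *ᵥ (diffM D D' a *ᵥ ((gmlT (N0 ℓ Mh k P) ℓ k D'.lev a * AR) *ᵥ μv))) x := by
    simp only [Matrix.mulVec_mulVec, Matrix.mul_assoc]
  rw [hident]
  refine hGux.trans ?_
  -- STEPS 4–5: block terms and the (2.61) sum
  have hsum : ∑ b : ↥(bset D.toDomains), Real.exp (-(1 / 4 * δ * (geomT D).dist y b)) ≤ c := h261 y
  calc ∑ b, KL y * Real.exp (-(δ * (geomT D).dist y b)) * Ublk D D' m δ aplus CR B y' b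
      ≤ ∑ b, KL y * (aplus * (CR * B))
          * (2 * ((ℓ : ℝ) + 1) ^ 2 * Real.exp (3 / 2 * δ) * (((ℓ : ℝ) + 1) ^ (m * k) / ((ℓ : ℝ) + 1) ^ (2 * k))
            * Real.exp (-(1 / 2 * δ * dOmega D D' y.1.2 y'.1.2)))
          * Real.exp (-(1 / 4 * δ * (geomT D).dist y b)) :=
        Finset.sum_le_sum fun b _ => block_term_le D D' hMh hP hRM m hKL hap0 hCR hδ hB hthr hy hy' b
    _ = KL y * (aplus * (CR * B))
          * (2 * ((ℓ : ℝ) + 1) ^ 2 * Real.exp (3 / 2 * δ) * (((ℓ : ℝ) + 1) ^ (m * k) / ((ℓ : ℝ) + 1) ^ (2 * k))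
            * Real.exp (-(1 / 2 * δ * dOmega D D' y.1.2 y'.1.2)))
          * ∑ b, Real.exp (-(1 / 4 * δ * (geomT D).dist y b)) := by rw [Finset.mul_sum]
    _ ≤ KL y * (aplus * (CR * B))
          * (2 * ((ℓ : ℝ) + 1) ^ 2 * Real.exp (3 / 2 * δ) * (((ℓ : ℝ) + 1) ^ (m * k) / ((ℓ : ℝ) + 1) ^ (2 * k))
            * Real.exp (-(1 / 2 * δ * dOmega D D' y.1.2 y'.1.2)))
          * c := mul_le_mul_of_nonneg_left hsum (by positivity)
    _ = _ := by ring

end Resolvent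

end

end Literature.MathematicalPhysics.QuantumFieldTheory.Balaban1983to89.B9Thm314GpFlatResolvent
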